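import Literature.AlgebraicGeometry.CossartJannsenSaito2020.ProjDirClosed
import Literature.RingTheory.HilbertSamuel.ProjDirectrixPlaneChart
import Mathlib.RingTheory.PrincipalIdealDomain
import Mathlib.Algebra.Polynomial.Div
import HarnessLib

/-!
# CJS LNM 2270, Def. 6.38 (ii) / Def. 6.34 (i) at `e_x(X) = 2`: `C_1 = ℙ(Dir_x(X)) ⊂ Bℓ_x(X)` is an irreducible CURVE —
# PROOF of the topological clauses of `ProjDir_projLine` (two charts `≅ 𝔸^1_{k(x)}`)

Source: V. Cossart, U. Jannsen, S. Saito, *Desingularization: Invariants and Strategy*, LNM **2270** (2020)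
[`CossartJannsenSaito2020`], Def. 6.38 (ii) (p. 105) «`C_1 = ℙ(Dir^O_x(X)) ≅ ℙ^1_{k(x)}`», p. 105 L13 «`C_q ≅ ℙ^1_{k(x)}`»,
p. 103 L15–L16 «Let `η_1` be the generic point of `C_1`». The named fact `ProjDir_projLine` (`ProjDirProjectiveLine.lean`)
types the point-set / local-ring consequences of this isomorphism. This file PROVES its TOPOLOGICAL clauses
(`projDirectrixFibre_projLine_topology`): for a blow-up `π : X' → X` of a locally noetherian `X` in a closed point `x` with
`e_x(X) = 2`, the set `C = projDirectrixFibre π x` is closed and IRREDUCIBLE, its generic point is NOT a closed point of `X'`,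
and every other point of `C` IS a closed point of `X'` (so `C` is one-dimensional, with the topology of `ℙ^1_{k(x)}`).

Proof. With `U ∋ x` affine, `𝔭 = 𝔭_x = (c_1, …, c_r)` maximal in `R = Γ(U)`, `𝒪_{X,x} = R_𝔭`, and the blow-up charts
`g_j : Spec R[𝔭/c_j] → X'` (`ProjDirClosed.lean`): since `e_x(X) = 2` the directrix space `𝒯 ⊆ 𝔪/𝔪²` has codimension two
and two of the `c_l`, say `c_{j₀}, c_{j₁}`, have symbols spanning `(𝔪/𝔪²)/𝒯` (`ProjDirectrixPlane.lean`); at every point of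
`C` the exceptional ideal is `(c_{j₀}, c_{j₁})`, hence generated by ONE of them, so `C ⊆ g_{j₀}(…) ∪ g_{j₁}(…)`. On the chart at
`c_{j₀}` the set `C` is `V(𝔑)` for the explicit ideal `𝔑` of `mem_projDirectrixFibre_chart_iff`, and
`R[𝔭/c_{j₀}]/𝔑 ≅ k(x)[T]`, `T = c_{j₁}/c_{j₀}` (`ProjDirectrixPlaneChart.lean`): so `𝔑` is a non-maximal prime all of whose
proper over-primes are maximal, and `c_{j₁}/c_{j₀} ∉ 𝔑`; symmetrically on the other chart. The point `η = g_{j₀}(𝔑)` lies on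
both charts (`chartGen ∉ 𝔑`), every point of `C` specialises from it (so `C = closure {η}` is irreducible with generic point
`η`, which is not closed since `𝔑` is not maximal), and a point `y ≠ η` of `C` corresponds to a maximal ideal on each chart
containing it, so `{y}` is closed in `X'` (a specialisation of `y` lies in `C`, hence on a chart through `y`).

Boundary-free, as the statement. NOT a statement of H. Hironaka's manuscript; a PROOF about a typed published notion of
[CJS 2020] for the L-lane of cell res-hironaka ([L W4.2], deal P-a, RECOGNITION (R1)). AI-written; weaker than expert review.
The local-ring clauses of `ProjDir_projLine` (regularity and dimension of `𝒪_{C,y}`) and `ProjDir_projLine_residueFields`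
are NOT proved here.

## References

* V. Cossart, U. Jannsen, S. Saito, LNM 2270 (2020), Def. 2.18, Def. 6.34 (i), Def. 6.38 (ii), p. 103, p. 105.
  [CossartJannsenSaito2020]
* The Stacks Project, Tag 0804 (charts of a blowing up). [StacksProject]
-/

noncomputable section

open CategoryTheory AlgebraicGeometry TopologicalSpace IsLocalRing
open Literature.AlgebraicGeometry.Resolution Literature.RingTheory.HilbertSamuel Literature.RingTheory.MvPolynomial

namespace Literature.AlgebraicGeometry.CossartJannsenSaito2020

universe u

/-! ## Plumbing (private copies of the chart lemmas of `ProjDirClosed.lean`) -/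

/-- The chart `g_j : Spec (R[It])_{(c_j t)} → X'` of a blowing up along `C` over an affine open `U` at a member `c_j` of a
generating family `c` of `C(U)`: an open immersion over `Spec R → X` through `chartBase c j`, containing every point at
which `c_j` generates the exceptional ideal. [cite: StacksProject, Tag 0804] -/
private theorem exists_chart_of_ideal_eq_span'' {X' X : Scheme.{u}} {π : X' ⟶ X} {C : X.IdealSheafData}
    (hπ : IsBlowup π C) (U : X.affineOpens) {r : ℕ} (c : Fin r → Γ(X, U))
    (hc : C.ideal U = Ideal.span (Set.range c)) (j : Fin r) :
    ∃ g : Spec (.of (chartRing c j)) ⟶ X', IsOpenImmersion g ∧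
      g ≫ π = Spec.map (CommRingCat.ofHom (chartBase c j)) ≫ U.2.fromSpec ∧
      ∀ (x' : X') (hx : π x' ∈ (U : X.Opens)),
        stalkIdeal (C.comap π) x' =
            Ideal.span {(π.stalkMap x').hom ((X.presheaf.germ U (π x') hx).hom (c j))} →
          x' ∈ Set.range g := by
  have key : ∀ (I : Ideal Γ(X, U)) (_ : C.ideal U = I) (b : Γ(X, U)) (hb : b ∈ I),
      ∃ g : Spec (.of (HomogeneousLocalization.Away (reesGrading I) (reesT b hb))) ⟶ X',
        IsOpenImmersion g ∧
        g ≫ π = Spec.map (CommRingCat.ofHom (reesChartBase b hb)) ≫ U.2.fromSpec ∧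
        ∀ (x' : X') (hx : π x' ∈ (U : X.Opens)),
          stalkIdeal (C.comap π) x' =
              Ideal.span {(π.stalkMap x').hom ((X.presheaf.germ U (π x') hx).hom b)} →
            x' ∈ Set.range g := by
    rintro I rfl b hb
    obtain ⟨g, h1, h2, -⟩ := hπ.exists_charts U
    exact ⟨g b hb, h1 b hb, h2 b hb, fun x' hx hgen =>
      hπ.mem_range_chart_of_stalkIdeal_eq_span U hb (g b hb) (h2 b hb) hx hgen⟩
  exact key _ hc (c j) (Ideal.mem_span_range_self (f := c) (x := j))

/-- On a chart `g : Spec D → X'` with `g ≫ π = Spec f ≫ (Spec Γ(X, U) → X)`: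
`g^♯_w ∘ π^♯_{g w} ∘ germ = (D → 𝒪_{Spec D, w}) ∘ f`. [cite: StacksProject, Tag 0804] -/
private theorem stalkMap_stalkMap_germ_of_chart'' {X' X : Scheme.{u}} (π : X' ⟶ X) (U : X.affineOpens)
    {D : CommRingCat.{u}} (g : Spec D ⟶ X') (f : Γ(X, U) ⟶ D)
    (hg : g ≫ π = Spec.map f ≫ U.2.fromSpec) (w : Spec D) (hx : π (g w) ∈ (U : X.Opens)) (r : Γ(X, U)) :
    (g.stalkMap w).hom ((π.stalkMap (g w)).hom ((X.presheaf.germ U (π (g w)) hx).hom r)) =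
      ((Spec D).presheaf.germ ⊤ w trivial).hom ((Scheme.ΓSpecIso D).inv.hom (f.hom r)) := by
  have e := top_le_preimage_of_chart U g f hg
  have h1 : ((Spec D).presheaf.germ ⊤ w trivial).hom ((g ≫ π).appLE U ⊤ e r) =
      ((g ≫ π).stalkMap w).hom ((X.presheaf.germ U ((g ≫ π) w) (e trivial)).hom r) := by
    change ((g ≫ π).appLE U ⊤ e ≫ (Spec D).presheaf.germ ⊤ w trivial).hom r =
      (X.presheaf.germ U ((g ≫ π) w) (e trivial) ≫ (g ≫ π).stalkMap w).hom r
    rw [Scheme.Hom.germ_stalkMap, Scheme.Hom.appLE, Category.assoc, (Spec D).presheaf.germ_res]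
  rw [appLE_chart_eq U g f hg e, Scheme.Hom.stalkMap_comp] at h1
  exact h1.symm

/-! ## Ring-level facts about an ideal `N ⊆ D` with `D/N ≅ k[T]` -/

section Quotient

variable {D : Type u} [CommRing D] {k : Type u} [Field k] (N : Ideal D) (Ξ : Polynomial k ≃+* D ⧸ N)

include Ξ in
/-- An ideal with quotient `≅ k[T]` is prime. [folklore] -/
private theorem isPrime_of_ringEquiv_polynomial : N.IsPrime := by
  haveI : IsDomain (D ⧸ N) := MulEquiv.isDomain (Polynomial k) Ξ.symm.toMulEquiv
  exact (Ideal.Quotient.isDomain_iff_prime N).mp inferInstance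

include Ξ in
/-- An ideal with quotient `≅ k[T]` is not maximal (`k[T]` is not a field). [folklore] -/
private theorem not_isMaximal_of_ringEquiv_polynomial : ¬ N.IsMaximal := by
  intro h
  have hF : IsField (D ⧸ N) := (Ideal.Quotient.maximal_ideal_iff_isField_quotient N).mp h
  exact Polynomial.not_isField k (MulEquiv.isField hF Ξ.toMulEquiv)

include Ξ in
/-- Over an ideal with quotient `≅ k[T]`, every strictly larger prime is maximal (`k[T]` is a PID of dimension one).
[folklore] -/
private theorem isMaximal_of_lt_of_ringEquiv_polynomial (w : Ideal D) [w.IsPrime] (hNw : N ≤ w) (hne : w ≠ N) :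
    w.IsMaximal := by
  -- `θ : D → k[T]`, surjective with kernel `N`
  let θ : D →+* Polynomial k := Ξ.symm.toRingHom.comp (Ideal.Quotient.mk N)
  have hθsurj : Function.Surjective θ := Ξ.symm.surjective.comp Ideal.Quotient.mk_surjective
  have hθker : RingHom.ker θ = N := by
    ext d
    rw [RingHom.mem_ker, RingHom.comp_apply, RingEquiv.toRingHom_eq_coe, RingHom.coe_coe,
      EmbeddingLike.map_eq_zero_iff, Ideal.Quotient.eq_zero_iff_mem]
  have hkw : RingHom.ker θ ≤ w := hθker ▸ hNw
  haveI hq : (w.map θ).IsPrime := Ideal.map_isPrime_of_surjective hθsurj hkw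
  have hqne : w.map θ ≠ ⊥ := by
    intro hbot
    apply hne
    refine le_antisymm ?_ hNw
    intro d hd
    have : θ d ∈ w.map θ := Ideal.mem_map_of_mem θ hd
    rw [hbot, Ideal.mem_bot, ← RingHom.mem_ker, hθker] at this
    exact this
  haveI : (w.map θ).IsMaximal := IsPrime.to_maximal_ideal hqne
  have hcomap : (w.map θ).comap θ = w := by
    rw [Ideal.comap_map_of_surjective θ hθsurj, sup_eq_left]
    intro d hd
    exact hkw hd
  rw [← hcomap]
  exact Ideal.comap_isMaximal_of_surjective θ hθsurj

include Ξ in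
/-- If `Ξ(T) = d̄` for the isomorphism `Ξ : k[T] ≅ D/N`, then `d ∉ N`. [folklore] -/
private theorem not_mem_of_ringEquiv_polynomial_X {d : D} (hΞ : Ξ Polynomial.X = Ideal.Quotient.mk N d) : d ∉ N := by
  intro hd
  have h0 : Ξ Polynomial.X = 0 := by rw [hΞ, Ideal.Quotient.eq_zero_iff_mem]; exact hd
  exact Polynomial.X_ne_zero (Ξ.injective (h0.trans (map_zero Ξ).symm))

end Quotient

/-! ## A local-ring lemma: an invertible ideal generated by two elements is generated by one of them -/

/-- In a local ring, if `(u, v) = (t)` with `t` a nonzerodivisor then `(u) = (t)` or `(v) = (t)`. [folklore] -/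
private theorem span_singleton_eq_or_of_span_pair_eq {B : Type u} [CommRing B] [IsLocalRing B] {u v t : B}
    (ht : t ∈ nonZeroDivisors B) (h : Ideal.span {u, v} = Ideal.span {t}) :
    Ideal.span {u} = Ideal.span {t} ∨ Ideal.span {v} = Ideal.span {t} := by
  obtain ⟨bu, hbu⟩ : ∃ b : B, b * t = u := Ideal.mem_span_singleton'.mp (h ▸ Ideal.subset_span (by simp))
  obtain ⟨bv, hbv⟩ : ∃ b : B, b * t = v := Ideal.mem_span_singleton'.mp (h ▸ Ideal.subset_span (by simp))
  obtain ⟨au, av, hauv⟩ : ∃ au av : B, au * u + av * v = t :=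
    Ideal.mem_span_pair.mp (h.symm ▸ Ideal.mem_span_singleton_self t)
  have hsum : au * bu + av * bv = 1 := by
    have h1 : (au * bu + av * bv - 1) * t = 0 := by
      rw [sub_mul, one_mul, add_mul, mul_assoc, mul_assoc, hbu, hbv, hauv, sub_self]
    exact sub_eq_zero.mp ((mem_nonZeroDivisors_iff_right.mp ht) _ h1)
  rcases IsLocalRing.isUnit_or_isUnit_of_add_one hsum with hu | hv
  · left
    rw [← hbu, Ideal.span_singleton_mul_left_unit (isUnit_of_mul_isUnit_right hu)]
  · right
    rw [← hbv, Ideal.span_singleton_mul_left_unit (isUnit_of_mul_isUnit_right hv)]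

/-! ## Symbols: the adapted pair is symmetric -/

/-- If `s ∉ 𝒯` and `s' ∉ 𝒯 + k s` then also `s' ∉ 𝒯` and `s ∉ 𝒯 + k s'`. [folklore] -/
private theorem pair_symm {k : Type u} [Field k] {V : Type u} [AddCommGroup V] [Module k V] {T : Submodule k V}
    {s s' : V} (hs : s ∉ T) (hs' : s' ∉ T ⊔ k ∙ s) : s' ∉ T ∧ s ∉ T ⊔ k ∙ s' := by
  refine ⟨fun h => hs' (Submodule.mem_sup_left h), fun h => ?_⟩
  obtain ⟨τ, hτ, w, hw, hτw⟩ := Submodule.mem_sup.mp h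
  obtain ⟨β, rfl⟩ := Submodule.mem_span_singleton.mp hw
  by_cases hβ : β = 0
  · apply hs
    rw [← hτw, hβ, zero_smul, add_zero]
    exact hτ
  · apply hs'
    have hs'eq : s' = β⁻¹ • s - β⁻¹ • τ := by
      rw [← hτw, smul_add, smul_smul, inv_mul_cancel₀ hβ, one_smul, add_sub_cancel_left]
    rw [hs'eq]
    exact Submodule.sub_mem _ (Submodule.mem_sup_right (Submodule.smul_mem _ _ (Submodule.mem_span_singleton_self _)))
      (Submodule.mem_sup_left (T.smul_mem _ hτ))

/-! ## One chart: the exceptional ideal at points where a ratio is invertible -/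

section Chart

variable {X' X : Scheme.{u}} [IsLocallyNoetherian X] (π : X' ⟶ X) (U : X.affineOpens) {x : X}
  (hxU : x ∈ (U : X.Opens))
  {D : CommRingCat.{u}} (ψ : Γ(X, U) ⟶ D) {r : ℕ} (c : Fin r → Γ(X, U)) (j : Fin r) (e : Fin r → D)
  (g : Spec D ⟶ X') [IsOpenImmersion g] (hgπ : g ≫ π = Spec.map ψ ≫ U.2.fromSpec)
  (hce : ∀ k, ψ.hom (c k) = ψ.hom (c j) * e k)
  (hx : IsClosed ({x} : Set X))
  (hIc : (Scheme.IdealSheafData.vanishingIdeal (⟨{x}, hx⟩ : Closeds X)).ideal U = Ideal.span (Set.range c))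

omit [IsLocallyNoetherian X] in
include hgπ hce hIc in
/-- **On the chart at `c_j`, wherever the ratio `e_l = c_l/c_j` is invertible the exceptional ideal is generated by `c_l`**
(so the point also lies on the chart at `c_l`, `IsBlowup.mem_range_chart_of_stalkIdeal_eq_span`): for `w` with `e_l ∉ 𝔭_w`,
`𝓘_{{x}}𝒪_{X',g w} = (π^♯ c_l)`. [cite: StacksProject, Tag 0804] -/
theorem stalkIdeal_exceptional_eq_span_of_notMem (w : Spec D) (hwU : π (g w) ∈ (U : X.Opens)) (l : Fin r)
    (hl : e l ∉ w.asIdeal) :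
    stalkIdeal ((Scheme.IdealSheafData.vanishingIdeal (⟨{x}, hx⟩ : Closeds X)).comap π) (g w) =
      Ideal.span {(π.stalkMap (g w)).hom ((X.presheaf.germ U (π (g w)) hwU).hom (c l))} := by
  classical
  -- the local dictionary
  let φ' : Γ(X, U) →+* X'.presheaf.stalk (g w) := (π.stalkMap (g w)).hom.comp (X.presheaf.germ U (π (g w)) hwU).hom
  let σ : ↑(X'.presheaf.stalk (g w)) ≃+* ↑((Spec D).presheaf.stalk w) :=
    (asIso (g.stalkMap w)).commRingCatIsoToRingEquiv
  have hσ : ∀ b, σ b = (g.stalkMap w).hom b := fun _ => rfl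
  let τ : D ⟶ (Spec D).presheaf.stalk w := (Scheme.ΓSpecIso D).inv ≫ (Spec D).presheaf.germ ⊤ w trivial
  letI : Algebra D ((Spec D).presheaf.stalk w) := τ.hom.toAlgebra
  haveI hlocL : IsLocalization.AtPrime ((Spec D).presheaf.stalk w) w.asIdeal :=
    StructureSheaf.IsLocalization.to_stalk (R := D) w
  have hστ : ∀ s : Γ(X, U), σ (φ' s) = τ.hom (ψ.hom s) := fun s =>
    stalkMap_stalkMap_germ_of_chart'' π U g ψ hgπ w hwU s
  have hτw : ∀ d : D, d ∈ w.asIdeal ↔ τ.hom d ∈ maximalIdeal ((Spec D).presheaf.stalk w) :=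
    fun d => (IsLocalization.AtPrime.to_map_mem_maximal_iff ((Spec D).presheaf.stalk w) w.asIdeal d).symm
  -- `τ(e_l)` is a unit
  have hunit : IsUnit (τ.hom (e l)) := by
    by_contra hnu
    exact hl ((hτw _).mpr ((mem_maximalIdeal _).mpr (mem_nonunits_iff.mpr hnu)))
  -- the exceptional ideal is `span (φ' ∘ c)`
  have hK : stalkIdeal ((Scheme.IdealSheafData.vanishingIdeal (⟨{x}, hx⟩ : Closeds X)).comap π) (g w) =
      Ideal.span (Set.range fun m => φ' (c m)) := by
    rw [stalkIdeal_comap_eq_map, stalkIdeal_eq_map_germ _ U hwU, hIc, Ideal.map_map, Ideal.map_span,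
      ← Set.range_comp]
    rfl
  rw [hK]
  apply le_antisymm
  · rw [Ideal.span_le]
    rintro _ ⟨m, rfl⟩
    -- `φ' c_m = φ' c_l · σ⁻¹((τ e_l)⁻¹ τ e_m)`
    have h1 : σ (φ' (c m)) = σ (φ' (c l)) * (↑(hunit.unit⁻¹) * τ.hom (e m)) := by
      rw [hστ, hστ, hce m, hce l, map_mul, map_mul, mul_assoc, ← mul_assoc (τ.hom (e l)), IsUnit.mul_val_inv,
        one_mul]
    have h2 : φ' (c m) = φ' (c l) * σ.symm (↑(hunit.unit⁻¹) * τ.hom (e m)) := by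
      apply σ.injective
      rw [map_mul, σ.apply_symm_apply]
      exact h1
    change φ' (c m) ∈ _
    rw [h2]
    exact Ideal.mul_mem_right _ _ (Ideal.mem_span_singleton_self _)
  · rw [Ideal.span_le, Set.singleton_subset_iff]
    exact Ideal.subset_span ⟨l, rfl⟩

end Chart

/-! ## The theorem -/

set_option maxHeartbeats 1600000 in
-- one long proof over large chart types (two Rees charts `chartRing c j` over `Γ(X, U)`), as in `ProjDirLine.lean`
/-- **CJS 2020, Def. 6.38 (ii) at `e_x(X) = 2`, topological part, PROVED: `C_1 = ℙ(Dir_x(X)) ⊂ Bℓ_x(X)` is a closed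
irreducible curve** — for a blow-up `π : X' ⟶ X` of a locally noetherian `X` in a closed point `x` with `e_x(X) = 2`, the set
`projDirectrixFibre π x` is closed and irreducible, its generic point is not a closed point of `X'`, and every other point
of it is a closed point of `X'` (module docstring for the proof: two charts `≅ Spec k(x)[T]`). These are clauses (1)–(4) of
the named fact `ProjDir_projLine` (`ProjDirProjectiveLine.lean`). [cite: CossartJannsenSaito2020, Def. 6.38 (ii), p. 105] -/
theorem projDirectrixFibre_projLine_topology {X X' : Scheme.{u}} [IsLocallyNoetherian X] (π : X' ⟶ X) (x : X)
    (hx : IsClosed ({x} : Set X)) (hπ : IsBlowup π (Scheme.IdealSheafData.vanishingIdeal ⟨{x}, hx⟩))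
    (hdir : Scheme.dirDim X x = 2) :
    IsClosed (projDirectrixFibre π x) ∧ IsIrreducible (projDirectrixFibre π x) ∧
      (∀ η : X', IsGenericPoint η (projDirectrixFibre π x) → ¬ IsClosed ({η} : Set X')) ∧
      (∀ y ∈ projDirectrixFibre π x, ¬ IsGenericPoint y (projDirectrixFibre π x) → IsClosed ({y} : Set X')) := by
  classical
  have hSclosed : IsClosed (projDirectrixFibre π x) := isClosed_projDirectrixFibre π x hx hπ
  set S := projDirectrixFibre π x with hS
  -- (0) the centre, an affine open `U ∋ x`, `𝔭 = 𝔭_x ⊆ R = Γ(X, U)`, `𝒪_{X,x} = R_𝔭`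
  obtain ⟨U, hxU⟩ : ∃ U : X.affineOpens, x ∈ (U : X.Opens) := by
    obtain ⟨U₀, hU, hxU, -⟩ :=
      exists_isAffineOpen_mem_and_subset (X := X) (x := x) (U := ⊤) (Opens.mem_top x)
    exact ⟨⟨U₀, hU⟩, hxU⟩
  set A := X.presheaf.stalk x with hA
  obtain ⟨𝔭, h𝔭⟩ : ∃ 𝔭 : PrimeSpectrum Γ(X, U), 𝔭 = U.2.primeIdealOf ⟨x, hxU⟩ := ⟨_, rfl⟩
  haveI h𝔭max : 𝔭.asIdeal.IsMaximal := h𝔭 ▸ U.2.primeIdealOf_isMaximal_of_isClosed ⟨x, hxU⟩ hx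
  haveI : IsNoetherianRing Γ(X, U) := IsLocallyNoetherian.component_noetherian U
  letI : Algebra Γ(X, U) A := TopCat.Presheaf.algebra_section_stalk X.presheaf (⟨x, hxU⟩ : (U : X.Opens))
  haveI hloc : IsLocalization.AtPrime A 𝔭.asIdeal := h𝔭 ▸ U.2.isLocalization_stalk ⟨x, hxU⟩
  have halg : ∀ s : Γ(X, U), algebraMap Γ(X, U) A s = (X.presheaf.germ U x hxU).hom s := fun _ => rfl
  have hI : (Scheme.IdealSheafData.vanishingIdeal (⟨{x}, hx⟩ : Closeds X)).ideal U = 𝔭.asIdeal := by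
    rw [h𝔭]
    exact vanishingIdeal_singleton_ideal U.2 hx hxU
  obtain ⟨r, c, hc⟩ : ∃ (r : ℕ) (c : Fin r → Γ(X, U)), Ideal.span (Set.range c) = 𝔭.asIdeal :=
    Submodule.fg_iff_exists_fin_generating_family.mp (IsNoetherian.noetherian 𝔭.asIdeal)
  have hIc : (Scheme.IdealSheafData.vanishingIdeal (⟨{x}, hx⟩ : Closeds X)).ideal U = Ideal.span (Set.range c) :=
    hI.trans hc.symm
  have hcm : ∀ l, algebraMap Γ(X, U) A (c l) ∈ maximalIdeal A :=
    fun l => (IsLocalization.AtPrime.to_map_mem_maximal_iff A 𝔭.asIdeal (c l)).mpr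
      (hc ▸ Ideal.subset_span ⟨l, rfl⟩)
  have hspanA : Ideal.span (Set.range fun l => algebraMap Γ(X, U) A (c l)) = maximalIdeal A := by
    have h := IsLocalization.AtPrime.map_eq_maximalIdeal 𝔭.asIdeal A
    rwa [← hc, Ideal.map_span, ← Set.range_comp] at h
  have hexp : ∀ l, ∃ a : Fin (maximalIdeal A).spanFinrank → A,
      ∑ i, a i * minGenerators A i = algebraMap Γ(X, U) A (c l) :=
    fun l => Ideal.mem_span_range_iff_exists_fun.mp (by rw [span_range_minGenerators]; exact hcm l)
  choose a ha using hexp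
  have ha' : ∀ l, algebraMap Γ(X, U) A (c l) = ∑ i, a l i * minGenerators A i := fun l => (ha l).symm
  have hd : directrixDim (tangentConeIdeal (minGenerators A) (span_range_minGenerators A)) = 2 := hdir
  -- (1) the charts at the generators, and the chart description of `S`
  have hcharts := fun j => exists_chart_of_ideal_eq_span'' hπ U c hIc j
  choose g hgopen hgπ hgmem using hcharts
  have hkey : ∀ (j : Fin r) (w : Spec (.of (chartRing c j))),
      g j w ∈ S ↔
        ((U.2.primeIdealOf ⟨x, hxU⟩).asIdeal.map (CommRingCat.ofHom (chartBase c j)).hom ⊔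
          Ideal.span {d : chartRing c j | ∃ lam : Fin r → Γ(X, U),
            (linForm fun i => ∑ l, residue (X.presheaf.stalk x) ((X.presheaf.germ U x hxU).hom (lam l)) *
                residue (X.presheaf.stalk x) (a l i)) ∈
              directrixSpace (canonicalTangentConeIdeal (X.presheaf.stalk x)) ∧
            d = ∑ l, (CommRingCat.ofHom (chartBase c j)).hom (lam l) * chartGen c j l}) ≤ w.asIdeal := by
    intro j w
    haveI := hgopen j
    exact mem_projDirectrixFibre_chart_iff π U hxU (CommRingCat.ofHom (chartBase c j)) c j
      (fun l => chartGen c j l) a (g j) (hgπ j) (fun k => reesChartBase_apply_eq_mul_chartGen c j k)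
      (reesChartBase_mem_nonZeroDivisors (c j) (Ideal.mem_span_range_self (f := c) (x := j))) hx
      (h𝔭 ▸ hc) ha w
  -- (2) an adapted pair of generators `c_{j₀}, c_{j₁}`
  obtain ⟨j₀, j₁, hj₀, hj₁⟩ := exists_pair_symbols_compl_directrixSpace (span_range_minGenerators A) rfl hspanA a ha' hd
  -- (3) per-chart structure for an adapted ordered pair `(i, i')`
  have hchart : ∀ (i i' : Fin r),
      linForm (fun m => residue A (a i m)) ∉
        directrixSpace (tangentConeIdeal (minGenerators A) (span_range_minGenerators A)) →
      linForm (fun m => residue A (a i' m)) ∉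
        directrixSpace (tangentConeIdeal (minGenerators A) (span_range_minGenerators A)) ⊔
          (ResidueField A) ∙ linForm (fun m => residue A (a i m)) →
      ∃ N : Ideal (chartRing c i), (∀ w : Spec (.of (chartRing c i)), g i w ∈ S ↔ N ≤ w.asIdeal) ∧
        N.IsPrime ∧ ¬ N.IsMaximal ∧
        (∀ w : Ideal (chartRing c i), w.IsPrime → N ≤ w → w ≠ N → w.IsMaximal) ∧ chartGen c i i' ∉ N := by
    intro i i' hi hi'
    letI : Field (Γ(X, U) ⧸ 𝔭.asIdeal) := Ideal.Quotient.field 𝔭.asIdeal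
    obtain ⟨Ξ, -, hΞX⟩ := exists_ringEquiv_polynomial_quotient_chartIdeal 𝔭.asIdeal A
      (span_range_minGenerators A) a ha (chartBase c i) (fun l => chartGen c i l) i i' (chartGen_self c i)
      (fun d => exists_isHomogeneous_eval₂_eq c i d) (fun m F hF => reesChartBase_eval_eq_pow_mul_eval₂ c i hF)
      (fun z hz => exists_pow_mul_eq_zero_of_reesChartBase_eq_zero c i hz) hi hi' hd
    refine ⟨_, fun w => ?_, isPrime_of_ringEquiv_polynomial _ Ξ, not_isMaximal_of_ringEquiv_polynomial _ Ξ,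
      fun w hw hNw hne => ?_, ?_⟩
    · rw [hkey i w, h𝔭]
      exact Iff.rfl
    · haveI := hw
      exact isMaximal_of_lt_of_ringEquiv_polynomial _ Ξ w hNw hne
    · exact not_mem_of_ringEquiv_polynomial_X _ Ξ hΞX
  obtain ⟨N₀, hkey₀, hprime₀, hnmax₀, hmax₀, hgen₀⟩ := hchart j₀ j₁ hj₀ hj₁
  obtain ⟨hj₁', hj₀'⟩ := pair_symm hj₀ hj₁
  obtain ⟨N₁, hkey₁, hprime₁, hnmax₁, hmax₁, hgen₁⟩ := hchart j₁ j₀ hj₁' hj₀'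
  haveI := hgopen j₀
  haveI := hgopen j₁
  -- the generic points of the two chart pieces
  set η₀pt : Spec (.of (chartRing c j₀)) := ⟨N₀, hprime₀⟩ with hη₀pt
  set η₁pt : Spec (.of (chartRing c j₁)) := ⟨N₁, hprime₁⟩ with hη₁pt
  have hη₀S : g j₀ η₀pt ∈ S := (hkey₀ η₀pt).mpr le_rfl
  have hη₁S : g j₁ η₁pt ∈ S := (hkey₁ η₁pt).mpr le_rfl
  -- (4) every point of `S` lies on one of the two charts
  have hcover2 : ∀ ξ ∈ S, ξ ∈ Set.range (g j₀) ∨ ξ ∈ Set.range (g j₁) := by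
    intro ξ hξ
    obtain ⟨hξx, hP⟩ := (mem_projDirectrixFibre π x ξ).mp hξ
    have hξU : π.base ξ ∈ (U : X.Opens) := hξx ▸ hxU
    -- `φ : 𝒪_{X,x} → 𝒪_{X',ξ}` and `φ' = π^♯ ∘ germ`
    let ι : A ≅ X.presheaf.stalk (π.base ξ) := X.presheaf.stalkCongr (.of_eq hξx.symm)
    haveI : IsLocalHom (π.stalkMap ξ).hom := π.toLRSHom.prop ξ
    let φ : A →+* X'.presheaf.stalk ξ := (π.stalkMap ξ).hom.comp ι.hom.hom
    have hφgerm : ∀ s : Γ(X, U), φ (algebraMap Γ(X, U) A s) =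
        (π.stalkMap ξ).hom ((X.presheaf.germ U (π.base ξ) hξU).hom s) := by
      intro s
      rw [halg, RingHom.comp_apply]
      change (π.stalkMap ξ).hom ((X.presheaf.germ U x hxU ≫ ι.hom).hom s) = _
      rw [TopCat.Presheaf.stalkCongr_hom, TopCat.Presheaf.germ_stalkSpecializes]
    have hφm : (maximalIdeal A).map φ ≤ maximalIdeal (X'.presheaf.stalk ξ) := by
      rw [Ideal.map_le_iff_le_comap]
      intro m hm
      rw [Ideal.mem_comap, RingHom.comp_apply]
      refine map_nonunit (π.stalkMap ξ).hom _ ?_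
      rw [mem_maximalIdeal, mem_nonunits_iff] at hm ⊢
      have h2 : ι.inv.hom (ι.hom.hom m) = m := by
        change (ι.hom ≫ ι.inv).hom m = m
        rw [Iso.hom_inv_id]
        rfl
      exact fun hu => hm (h2 ▸ hu.map ι.inv.hom)
    have hPφ : ProjDirLiftsInto φ (minGenerators A) (span_range_minGenerators A) :=
      (isOnProjDirectrix_iff_projDirLiftsInto π hξx).mp hP
    have hpair := map_maximalIdeal_eq_span_pair_of_projDirLiftsInto (span_range_minGenerators A) a ha' hj₀ hj₁ hd φ
      hφm hPφ
    -- the exceptional ideal at `ξ` is `𝔪_x 𝒪_ξ = (φ' c_{j₀}, φ' c_{j₁})`, principal and generated by a nonzerodivisor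
    obtain ⟨t, ht, hKt⟩ := hπ.isEffectiveCartier.exists_stalkIdeal_eq_span ξ
    have hK : stalkIdeal ((Scheme.IdealSheafData.vanishingIdeal (⟨{x}, hx⟩ : Closeds X)).comap π) ξ =
        Ideal.span {(π.stalkMap ξ).hom ((X.presheaf.germ U (π.base ξ) hξU).hom (c j₀)),
          (π.stalkMap ξ).hom ((X.presheaf.germ U (π.base ξ) hξU).hom (c j₁))} := by
      rw [stalkIdeal_comap_eq_map, stalkIdeal_eq_map_germ _ U hξU, hIc, Ideal.map_map, Ideal.map_span,
        ← Set.range_comp]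
      have h1 : Ideal.span (Set.range (((π.stalkMap ξ).hom.comp (X.presheaf.germ U (π.base ξ) hξU).hom) ∘ c)) =
          (maximalIdeal A).map φ := by
        rw [← hspanA, Ideal.map_span, ← Set.range_comp]
        exact congrArg Ideal.span (congrArg Set.range (funext fun l => (hφgerm (c l)).symm))
      rw [h1, hpair, hφgerm, hφgerm]
    rcases span_singleton_eq_or_of_span_pair_eq ht (hK.symm.trans hKt) with h0 | h1
    · exact Or.inl (hgmem j₀ ξ hξU (hKt.trans h0.symm))
    · exact Or.inr (hgmem j₁ ξ hξU (hKt.trans h1.symm))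
  -- (5) specialisation from the chart generic points
  have hspec₀ : ∀ w : Spec (.of (chartRing c j₀)), g j₀ w ∈ S → g j₀ η₀pt ⤳ g j₀ w := by
    intro w hw
    have hsp : η₀pt ⤳ w :=
      (PrimeSpectrum.le_iff_specializes η₀pt w).mp ((PrimeSpectrum.asIdeal_le_asIdeal η₀pt w).mp ((hkey₀ w).mp hw))
    exact hsp.map (g j₀).continuous
  have hspec₁ : ∀ w : Spec (.of (chartRing c j₁)), g j₁ w ∈ S → g j₁ η₁pt ⤳ g j₁ w := by
    intro w hw
    have hsp : η₁pt ⤳ w :=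
      (PrimeSpectrum.le_iff_specializes η₁pt w).mp ((PrimeSpectrum.asIdeal_le_asIdeal η₁pt w).mp ((hkey₁ w).mp hw))
    exact hsp.map (g j₁).continuous
  -- each chart generic point lies on the other chart
  have hη₁range₀ : g j₁ η₁pt ∈ Set.range (g j₀) := by
    have hwU : π (g j₁ η₁pt) ∈ (U : X.Opens) := ((mem_projDirectrixFibre π x _).mp hη₁S).1 ▸ hxU
    exact hgmem j₀ _ hwU (stalkIdeal_exceptional_eq_span_of_notMem π U (CommRingCat.ofHom (chartBase c j₁)) c j₁
      (fun l => chartGen c j₁ l) (g j₁) (hgπ j₁) (fun k => reesChartBase_apply_eq_mul_chartGen c j₁ k) hx hIc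
      η₁pt hwU j₀ hgen₁)
  have hη₀range₁ : g j₀ η₀pt ∈ Set.range (g j₁) := by
    have hwU : π (g j₀ η₀pt) ∈ (U : X.Opens) := ((mem_projDirectrixFibre π x _).mp hη₀S).1 ▸ hxU
    exact hgmem j₁ _ hwU (stalkIdeal_exceptional_eq_span_of_notMem π U (CommRingCat.ofHom (chartBase c j₀)) c j₀
      (fun l => chartGen c j₀ l) (g j₀) (hgπ j₀) (fun k => reesChartBase_apply_eq_mul_chartGen c j₀ k) hx hIc
      η₀pt hwU j₁ hgen₀)
  have hη₀η₁ : g j₀ η₀pt ⤳ g j₁ η₁pt := by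
    obtain ⟨w, hw⟩ := hη₁range₀
    rw [← hw]
    exact hspec₀ w (hw ▸ hη₁S)
  have hη₁η₀ : g j₁ η₁pt ⤳ g j₀ η₀pt := by
    obtain ⟨w, hw⟩ := hη₀range₁
    rw [← hw]
    exact hspec₁ w (hw ▸ hη₀S)
  -- (6) `η₀ := g_{j₀}(N₀)` and `η₁` are generic points of `S`
  have hgen : ∀ ξ ∈ S, g j₀ η₀pt ⤳ ξ := by
    intro ξ hξ
    rcases hcover2 ξ hξ with ⟨w, rfl⟩ | ⟨w, rfl⟩
    · exact hspec₀ w hξ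
    · exact hη₀η₁.trans (hspec₁ w hξ)
  have hGP₀ : IsGenericPoint (g j₀ η₀pt) S := by
    refine isGenericPoint_iff_specializes.mpr fun ξ => ⟨fun h => ?_, fun h => hgen ξ h⟩
    exact hSclosed.closure_subset_iff.mpr (Set.singleton_subset_iff.mpr hη₀S) (specializes_iff_mem_closure.mp h)
  have hGP₁ : IsGenericPoint (g j₁ η₁pt) S := by
    refine isGenericPoint_iff_specializes.mpr fun ξ => ⟨fun h => ?_, fun h => hη₁η₀.trans (hgen ξ h)⟩
    exact hSclosed.closure_subset_iff.mpr (Set.singleton_subset_iff.mpr hη₁S) (specializes_iff_mem_closure.mp h)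
  refine ⟨hSclosed, hGP₀.isIrreducible, ?_, ?_⟩
  · -- (7) the generic point is not closed
    intro η hη hcl
    have hηeq : η = g j₀ η₀pt := hη.eq hGP₀
    subst hηeq
    have hpre : IsClosed ({η₀pt} : Set (Spec (.of (chartRing c j₀)))) := by
      have h1 : (g j₀) ⁻¹' {g j₀ η₀pt} = {η₀pt} := by
        ext w
        simp only [Set.mem_preimage, Set.mem_singleton_iff]
        exact ⟨fun h => (g j₀).isOpenEmbedding.injective h, fun h => by rw [h]⟩
      rw [← h1]
      exact hcl.preimage (g j₀).continuous
    exact hnmax₀ ((PrimeSpectrum.isClosed_singleton_iff_isMaximal η₀pt).mp hpre)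
  · -- (8) every other point is closed
    intro y hy hny
    refine isClosed_of_closure_subset fun ζ hζ => ?_
    have hζS : ζ ∈ S := hSclosed.closure_subset_iff.mpr (Set.singleton_subset_iff.mpr hy) hζ
    have hyζ : y ⤳ ζ := specializes_iff_mem_closure.mpr hζ
    rw [Set.mem_singleton_iff]
    -- work on a chart containing `ζ`, hence `y`
    have main : ∀ (i : Fin r) (N : Ideal (chartRing c i)), IsOpenImmersion (g i) →
        (∀ w : Spec (.of (chartRing c i)), g i w ∈ S ↔ N ≤ w.asIdeal) → N.IsPrime →
        (∀ w : Ideal (chartRing c i), w.IsPrime → N ≤ w → w ≠ N → w.IsMaximal) →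
        (∀ hN : N.IsPrime, IsGenericPoint (g i ⟨N, hN⟩) S) →
        ζ ∈ Set.range (g i) → ζ = y := by
      intro i N hgi hkeyi hNp hmaxi hGPi hζi
      haveI := hgi
      have hyi : y ∈ Set.range (g i) := hyζ.mem_open (g i).isOpenEmbedding.isOpen_range hζi
      obtain ⟨w, rfl⟩ := hyi
      obtain ⟨w₂, rfl⟩ := hζi
      have hww₂ : w ⤳ w₂ := ((g i).isOpenEmbedding.toIsEmbedding.toIsInducing.specializes_iff).mp hyζ
      have hle : w.asIdeal ≤ w₂.asIdeal :=
        (PrimeSpectrum.asIdeal_le_asIdeal w w₂).mpr ((PrimeSpectrum.le_iff_specializes w w₂).mpr hww₂)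
      have hNw : N ≤ w.asIdeal := (hkeyi w).mp hy
      have hwne : w.asIdeal ≠ N := by
        intro heq
        apply hny
        have : w = ⟨N, hNp⟩ := PrimeSpectrum.ext heq
        rw [this]
        exact hGPi hNp
      haveI hwmax : w.asIdeal.IsMaximal := hmaxi w.asIdeal w.isPrime hNw hwne
      have heq : w₂.asIdeal = w.asIdeal := (hwmax.eq_of_le w₂.isPrime.ne_top hle).symm
      rw [PrimeSpectrum.ext heq]
    rcases hcover2 ζ hζS with h0 | h1
    · exact main j₀ N₀ (hgopen j₀) hkey₀ hprime₀ hmax₀ (fun _ => hGP₀) h0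
    · exact main j₁ N₁ (hgopen j₁) hkey₁ hprime₁ hmax₁ (fun _ => hGP₁) h1

end Literature.AlgebraicGeometry.CossartJannsenSaito2020

end
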